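import Summits.CriticalPhenomena.Ising3DConformalLimit.Theses.PerfectScreening
import Summits.CriticalPhenomena.Ising3DConformalLimit.Theses.LeeYangGap
import Summits.CriticalPhenomena.Ising3DConformalLimit.Theses.SubPtolemyInterlacing
import Summits.CriticalPhenomena.Ising3DConformalLimit.Theses.HyperoctahedralRP
import Summits.CriticalPhenomena.Ising3DConformalLimit.Theorems.PlantedPinningMoebiusLimitExistsWardDoorTight
import Summits.CriticalPhenomena.Ising3DConformalLimit.Theorems.PlantedPinningMoebiusLimitExistsTwoLeaf
import Literature.Probability.LatticeModels.SCTWardIdentity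
import Mathlib.MeasureTheory.Integral.DominatedConvergence
import Mathlib.MeasureTheory.Function.Floor
import Mathlib.Topology.UniformSpace.LocallyUniformConvergence
import Mathlib.Analysis.Normed.Group.Bounded
import HarnessLib

/-!
# The LATTICE Ward door for crux `MoebiusLimitExists` (stmt-CriticalPhenomena-1344): the weak special-conformal Ward identity of a
# pointwise scaling limit is an ASYMPTOTIC identity of the rescaled LATTICE correlators
(line `Sketch`, lead prover-line-stmt-CriticalPhenomena-1344-c17-0, route LeeYangGap, bet route SubPtolemyInterlacing; THEOREM-ONLY,
`--supports stmt-CriticalPhenomena-1344`)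

Skeleton v10 of line `Sketch` (lead c16) has ONE registered residual, 7″ `stub_interiorWardUpgradeStrict`: every interacting
open-window pointwise scaling limit `S` of the critical `ℤ³` Ising correlators satisfies the weak special-conformal Ward identities
`∀ n, SCTWardWeak S Δ n` (`Literature.Probability.LatticeModels.SCTWardWeak`), and the Ward door is tight
(`MoebiusLimitExists_iff_existence_and_wardStrict`, `inversionUpgradeNormalised_iff_wardUpgrade`, p149203).  The Ward form was
chosen because it is the LOCAL LINEAR form in which a lattice mechanism (a lattice Ward identity / discrete stress tensor on `ℤ³`)
would deliver the conjecture content — but 7″ is still a statement about the LIMIT OBJECT `S`.  This file moves the residual onto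
the lattice:

* `tendsto_integral_rescaledCorrelator_mul` (any `d`, any lattice family `G`): if `ρ(δ)ⁿ G n ([x/δ]) → S n x` locally uniformly on
  `NonCoincident d n` and `S n` is continuous there, then for every continuous test function `ψ` compactly supported off the
  diagonals `∫ ρ(δ)ⁿ G n([x/δ]) ψ(x) dx → ∫ S n(x) ψ(x) dx` as `δ → 0⁺` (uniform convergence on the compact support + dominated
  convergence; the rescaled correlators are measurable step functions, `measurable_rescaledCorrelator`);
* `integral_mul_sctTestOp_eq_zero_iff_tendsto` / `sctWardWeak_iff_latticeWard`: hence, for a pointwise limit `S` of `criticalCorr 3`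
  (continuity off the diagonals is FREE, `continuousOn_of_limit`), the weak Ward identity `∫ S n · 𝒦ᵀφ = 0` for ONE test pair
  `(b, φ)` holds IFF the LATTICE Ward functional `δ ↦ ∫ ρ(δ)ⁿ ⟨σ_{[x₁/δ]} ⋯ σ_{[xₙ/δ]}⟩_{β_c} 𝒦ᵀ_{b}φ(x) dx` tends to `0` as `δ → 0⁺`
  (`𝒦ᵀ_b φ = sctTestOp Δ n b φ = (2Δ−6)(Σᵢ b·xᵢ)φ + Dφ·(K_b(xᵢ))ᵢ`), i.e. iff the rescaled critical correlators satisfy the continuum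
  SCT Ward identity ASYMPTOTICALLY in the weak sense — a statement in which the limit object does not occur;
* by-name consequences: **item 1982 ⟺ the lattice Ward upgrade** (`inversionUpgradeNormalised_iff_latticeWardUpgrade`, and the
  `S`-free curried form `inversionUpgradeNormalised_iff_latticeWardUpgrade'`), **crux ⟺ 1981 ∧ lattice Ward upgrade**
  (`MoebiusLimitExists_iff_existence_and_latticeWardUpgrade`, with the LeeYangGap and SubPtolemyInterlacing spellings), and the
  one-directional door `sctWardWeak_of_latticeWard` used by the skeleton (7‴ ⇒ 7″).

So the census of kernel-checked equivalent residuals of crux 1344 now reads `crux ⟺ 1981 ∧ X`,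
`X ∈ {1982, 7′, 7″, 7‴ (lattice Ward), 4840, 4671}`; 7‴ and 4840 are the two lattice-language forms (4840 for the finite inversion,
7‴ for its infinitesimal generator), and 7‴ is the precise target a discrete conformal Ward identity on `ℤ³` would have to hit.

References: Di Francesco–Mathieu–Sénéchal 1997 §4.1 (4.14)–(4.19), §4.3.1 (4.51)–(4.54) [FrancescoMathieuSenechal1997];
Chelkak–Hongler–Izyurov 2015 Thm 1.1 (the shape of `HasPointwiseScalingLimit`) [ChelkakHonglerIzyurov2015]; Duminil-Copin, Proc. ICM
2022 §8.4 (existence and conformal invariance of the `ℤ³` limit are open) [DuminilCopinICM2022].  No definitions, no `sorry`.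
-/

noncomputable section

namespace Summit.CriticalPhenomena.Ising3DConformalLimit.MoebiusLimitExistsLatticeWard

open Filter Topology MeasureTheory Set
open Literature.Probability.LatticeModels
open Summit.CriticalPhenomena.Ising3DConformalLimit.Theses
open Summit.CriticalPhenomena.Ising3DConformalLimit.MoebiusLimitExistsWardDoor
  (continuousOn_of_limit inversionUpgradeNormalised_iff_wardUpgrade)
open Summit.CriticalPhenomena.Ising3DConformalLimit.MoebiusLimitExistsTwoLeaf
  (MoebiusLimitExists_iff_leaves leeYangGap_MoebiusLimitExists_iff_leaves subPtolemyInterlacing_MoebiusLimit_iff_leaves)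

variable {d : ℕ}

/-! ## The rescaled correlators are measurable step functions -/

/-- The mesh map `x ↦ ([x₁/δ], …, [xₙ/δ])` is measurable (coordinatewise `⌊·/δ⌋`). [folklore] -/
theorem measurable_latticeCfg (n : ℕ) (δ : ℝ) :
    Measurable (fun (x : Fin n → EuclideanSpace ℝ (Fin d)) (i : Fin n) => latticeApprox δ (x i)) := by
  refine measurable_pi_lambda _ fun i => measurable_pi_lambda _ fun j => ?_
  have h : Measurable fun x : Fin n → EuclideanSpace ℝ (Fin d) => (x i) j / δ :=
    ((EuclideanSpace.proj j).continuous.measurable.comp (measurable_pi_apply i)).div_const δ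
  simpa [latticeApprox] using h.floor

/-- The rescaled correlator `x ↦ ρ(δ)ⁿ G n ([x₁/δ], …, [xₙ/δ])` is measurable (a function of the countably-valued mesh map).
[folklore] -/
theorem measurable_rescaledCorrelator (G : LatticeCorrFamily d) (ρ : ℝ → ℝ) (n : ℕ) (δ : ℝ) :
    Measurable (rescaledCorrelator G ρ n δ) := by
  have h : rescaledCorrelator G ρ n δ = (fun z : Fin n → Site d => ρ δ ^ n * G n z) ∘
      fun (x : Fin n → EuclideanSpace ℝ (Fin d)) (i : Fin n) => latticeApprox δ (x i) := by
    funext x; rfl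
  rw [h]
  exact (measurable_of_countable _).comp (measurable_latticeCfg n δ)

/-! ## Integrals of the rescaled correlators against test functions converge -/

/-- **Smeared convergence off the diagonals.**  If `ρ(δ)ⁿ G n([x/δ]) → S n (x)` locally uniformly on `NonCoincident d n` as
`δ → 0⁺` and `S n` is continuous there, then for every continuous `ψ` with compact support inside `NonCoincident d n`,
`∫ ρ(δ)ⁿ G n([x/δ]) ψ(x) dx → ∫ S n(x) ψ(x) dx` (uniform convergence on the compact support, dominated convergence with the bound
`(sup_K |S n| + 1)|ψ|`). [cite: ChelkakHonglerIzyurov2015, Thm 1.1] -/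
theorem tendsto_integral_rescaledCorrelator_mul {G : LatticeCorrFamily d} {ρ : ℝ → ℝ} {S : CorrFamily d} {n : ℕ}
    (hlim : HasPointwiseScalingLimit G ρ S) (hS : ContinuousOn (S n) (NonCoincident d n))
    {ψ : (Fin n → EuclideanSpace ℝ (Fin d)) → ℝ} (hψ : Continuous ψ) (hψc : HasCompactSupport ψ)
    (hsupp : tsupport ψ ⊆ NonCoincident d n) :
    Tendsto (fun δ => ∫ x, rescaledCorrelator G ρ n δ x * ψ x) (𝓝[>] (0:ℝ))
      (𝓝 (∫ x, S n x * ψ x)) := by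
  set K : Set (Fin n → EuclideanSpace ℝ (Fin d)) := tsupport ψ with hK
  have hKc : IsCompact K := hψc
  -- uniform convergence on the compact support
  have hunif : TendstoUniformlyOn (rescaledCorrelator G ρ n) (S n) (𝓝[>] (0:ℝ)) K :=
    (tendstoLocallyUniformlyOn_iff_forall_isCompact (isOpen_nonCoincident d n)).1 (hlim n) K hsupp hKc
  -- a bound for `S n` on `K`
  obtain ⟨M, hM⟩ := hKc.exists_bound_of_continuousOn (hS.mono hsupp)
  have hev : ∀ᶠ δ in 𝓝[>] (0:ℝ), ∀ x ∈ K, dist (S n x) (rescaledCorrelator G ρ n δ x) < 1 :=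
    Metric.tendstoUniformlyOn_iff.1 hunif 1 one_pos
  refine tendsto_integral_filter_of_dominated_convergence (fun x => (M + 1) * ‖ψ x‖) ?_ ?_ ?_ ?_
  · exact Eventually.of_forall fun δ =>
      ((measurable_rescaledCorrelator G ρ n δ).mul hψ.measurable).aestronglyMeasurable
  · filter_upwards [hev] with δ hδ
    refine Eventually.of_forall fun x => ?_
    by_cases hx : x ∈ K
    · have hd := hδ x hx
      rw [Real.dist_eq] at hd
      have hSx : ‖S n x‖ ≤ M := hM x hx
      rw [Real.norm_eq_abs] at hSx
      have htri : |rescaledCorrelator G ρ n δ x| ≤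
          |S n x| + |S n x - rescaledCorrelator G ρ n δ x| := by
        have := abs_sub_abs_le_abs_sub (rescaledCorrelator G ρ n δ x) (S n x)
        rw [abs_sub_comm] at this
        linarith
      have h1 : |rescaledCorrelator G ρ n δ x| ≤ M + 1 := by linarith
      rw [norm_mul, Real.norm_eq_abs]
      exact mul_le_mul_of_nonneg_right h1 (norm_nonneg _)
    · have hψ0 : ψ x = 0 := image_eq_zero_of_notMem_tsupport hx
      simp [hψ0]
  · exact (hψ.integrable_of_hasCompactSupport hψc).norm.const_mul (M + 1)
  · refine Eventually.of_forall fun x => ?_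
    by_cases hx : x ∈ K
    · exact ((hlim n).tendsto_at (hsupp hx)).mul_const (ψ x)
    · have hψ0 : ψ x = 0 := image_eq_zero_of_notMem_tsupport hx
      simp only [hψ0, mul_zero]
      exact tendsto_const_nhds

/-! ## The adjoint SCT operator maps test functions to test functions -/

/-- `𝒦ᵀ_b φ = sctTestOp Δ n b φ` is continuous for smooth `φ`. [cite: FrancescoMathieuSenechal1997, §4.1 (4.18)] -/
theorem continuous_sctTestOp (Δ : ℝ) (n : ℕ) (b : EuclideanSpace ℝ (Fin d))
    {φ : (Fin n → EuclideanSpace ℝ (Fin d)) → ℝ} (hφ : ContDiff ℝ ((⊤ : ℕ∞) : WithTop ℕ∞) φ) :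
    Continuous (sctTestOp Δ n b φ) := by
  have hφc : Continuous φ := hφ.continuous
  have hdf : Continuous (fderiv ℝ φ) := hφ.continuous_fderiv (by simp)
  have hv : Continuous fun (x : Fin n → EuclideanSpace ℝ (Fin d)) (i : Fin n) =>
      ‖x i‖ ^ 2 • b - (2 * inner ℝ b (x i)) • x i := by
    refine continuous_pi fun i => ?_
    fun_prop
  have h2 : Continuous fun (x : Fin n → EuclideanSpace ℝ (Fin d)) =>
      fderiv ℝ φ x (fun i => ‖x i‖ ^ 2 • b - (2 * inner ℝ b (x i)) • x i) :=
    hdf.clm_apply hv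
  have h : Continuous fun x => (2 * Δ - 2 * d) * (∑ i, inner ℝ b (x i)) * φ x +
      fderiv ℝ φ x (fun i => ‖x i‖ ^ 2 • b - (2 * inner ℝ b (x i)) • x i) := by
    fun_prop
  exact h

/-- `𝒦ᵀ_b φ` vanishes off the topological support of `φ` (there `φ = 0` and `Dφ = 0`). [folklore] -/
theorem sctTestOp_eq_zero_of_notMem (Δ : ℝ) (n : ℕ) (b : EuclideanSpace ℝ (Fin d))
    {φ : (Fin n → EuclideanSpace ℝ (Fin d)) → ℝ} {x : Fin n → EuclideanSpace ℝ (Fin d)}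
    (hx : x ∉ tsupport φ) : sctTestOp Δ n b φ x = 0 := by
  have h0 : φ x = 0 := image_eq_zero_of_notMem_tsupport hx
  have h1 : fderiv ℝ φ x = 0 :=
    image_eq_zero_of_notMem_tsupport fun h => hx (tsupport_fderiv_subset (𝕜 := ℝ) h)
  simp [sctTestOp, h0, h1]

/-- The topological support of `𝒦ᵀ_b φ` lies in that of `φ`. [folklore] -/
theorem tsupport_sctTestOp_subset (Δ : ℝ) (n : ℕ) (b : EuclideanSpace ℝ (Fin d))
    (φ : (Fin n → EuclideanSpace ℝ (Fin d)) → ℝ) : tsupport (sctTestOp Δ n b φ) ⊆ tsupport φ := by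
  refine closure_minimal (fun x hx => ?_) (isClosed_tsupport φ)
  by_contra h
  exact hx (sctTestOp_eq_zero_of_notMem Δ n b h)

/-- `𝒦ᵀ_b φ` has compact support if `φ` has. [folklore] -/
theorem hasCompactSupport_sctTestOp (Δ : ℝ) (n : ℕ) (b : EuclideanSpace ℝ (Fin d))
    {φ : (Fin n → EuclideanSpace ℝ (Fin d)) → ℝ} (hφc : HasCompactSupport φ) :
    HasCompactSupport (sctTestOp Δ n b φ) :=
  HasCompactSupport.of_support_subset_isCompact hφc
    ((subset_tsupport _).trans (tsupport_sctTestOp_subset Δ n b φ))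

/-! ## The lattice Ward functional converges to the Ward functional of the limit -/

/-- **The lattice Ward functional converges**: for a pointwise limit continuous off the diagonals and a smooth test function `φ`
compactly supported off the diagonals, `∫ ρ(δ)ⁿ G n([x/δ]) 𝒦ᵀ_bφ(x) dx → ∫ S n(x) 𝒦ᵀ_bφ(x) dx` as `δ → 0⁺`.
[cite: FrancescoMathieuSenechal1997, §4.3.1 (4.51)–(4.54)] -/
theorem tendsto_integral_rescaledCorrelator_sctTestOp {G : LatticeCorrFamily d} {ρ : ℝ → ℝ} {S : CorrFamily d}
    {n : ℕ} (hlim : HasPointwiseScalingLimit G ρ S) (hS : ContinuousOn (S n) (NonCoincident d n)) (Δ : ℝ)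
    (b : EuclideanSpace ℝ (Fin d)) {φ : (Fin n → EuclideanSpace ℝ (Fin d)) → ℝ}
    (hφ : ContDiff ℝ ((⊤ : ℕ∞) : WithTop ℕ∞) φ) (hφc : HasCompactSupport φ) (hsupp : tsupport φ ⊆ NonCoincident d n) :
    Tendsto (fun δ => ∫ x, rescaledCorrelator G ρ n δ x * sctTestOp Δ n b φ x) (𝓝[>] (0:ℝ))
      (𝓝 (∫ x, S n x * sctTestOp Δ n b φ x)) :=
  tendsto_integral_rescaledCorrelator_mul hlim hS (continuous_sctTestOp Δ n b hφ)
    (hasCompactSupport_sctTestOp Δ n b hφc) ((tsupport_sctTestOp_subset Δ n b φ).trans hsupp)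

/-- **One test pair at a time**: the weak Ward identity `∫ S n · 𝒦ᵀ_bφ = 0` of the limit holds IFF the LATTICE Ward functional
`δ ↦ ∫ ρ(δ)ⁿ G n([x/δ]) 𝒦ᵀ_bφ(x) dx` tends to `0` as `δ → 0⁺`. [cite: FrancescoMathieuSenechal1997, §4.3.1 (4.51)–(4.54)] -/
theorem integral_mul_sctTestOp_eq_zero_iff_tendsto {G : LatticeCorrFamily d} {ρ : ℝ → ℝ} {S : CorrFamily d}
    {n : ℕ} (hlim : HasPointwiseScalingLimit G ρ S) (hS : ContinuousOn (S n) (NonCoincident d n)) (Δ : ℝ)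
    (b : EuclideanSpace ℝ (Fin d)) {φ : (Fin n → EuclideanSpace ℝ (Fin d)) → ℝ}
    (hφ : ContDiff ℝ ((⊤ : ℕ∞) : WithTop ℕ∞) φ) (hφc : HasCompactSupport φ) (hsupp : tsupport φ ⊆ NonCoincident d n) :
    ∫ x, S n x * sctTestOp Δ n b φ x = 0 ↔
      Tendsto (fun δ => ∫ x, rescaledCorrelator G ρ n δ x * sctTestOp Δ n b φ x) (𝓝[>] (0:ℝ)) (𝓝 0) := by
  have ht := tendsto_integral_rescaledCorrelator_sctTestOp hlim hS Δ b hφ hφc hsupp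
  constructor
  · intro h
    rwa [h] at ht
  · intro h
    exact tendsto_nhds_unique ht h

/-- **Weak Ward identity at level `n` ⟺ asymptotic lattice Ward identity at level `n`** (any `d`, any lattice family, given
continuity of the limit off the diagonals). [cite: FrancescoMathieuSenechal1997, §4.3.1 (4.51)–(4.54)] -/
theorem sctWardWeak_iff_latticeWard_of_continuousOn {G : LatticeCorrFamily d} {ρ : ℝ → ℝ} {S : CorrFamily d} {n : ℕ}
    (hlim : HasPointwiseScalingLimit G ρ S) (hS : ContinuousOn (S n) (NonCoincident d n)) (Δ : ℝ) :
    SCTWardWeak S Δ n ↔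
      ∀ (b : EuclideanSpace ℝ (Fin d)) (φ : (Fin n → EuclideanSpace ℝ (Fin d)) → ℝ),
        ContDiff ℝ ((⊤ : ℕ∞) : WithTop ℕ∞) φ → HasCompactSupport φ → tsupport φ ⊆ NonCoincident d n →
          Tendsto (fun δ => ∫ x, rescaledCorrelator G ρ n δ x * sctTestOp Δ n b φ x) (𝓝[>] (0:ℝ)) (𝓝 0) := by
  rw [sctWardWeak_iff_sctTestOp]
  exact forall_congr' fun b => forall_congr' fun φ => forall_congr' fun hφ =>
    forall_congr' fun hφc => forall_congr' fun hsupp =>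
      integral_mul_sctTestOp_eq_zero_iff_tendsto hlim hS Δ b hφ hφc hsupp

/-! ## The critical `ℤ³` Ising correlators: continuity off the diagonals is free -/

/-- **7″ ⟺ 7‴ levelwise, for every pointwise limit of `criticalCorr 3`**: the weak special-conformal Ward identity of `S n` with
weight `Δ` holds iff the rescaled critical lattice correlators satisfy it asymptotically in the weak sense,
`∫ ρ(δ)ⁿ ⟨σ_{[x₁/δ]} ⋯ σ_{[xₙ/δ]}⟩⁺_{β_c} 𝒦ᵀ_bφ(x) dx → 0` for all `b` and all smooth `φ` compactly supported off the diagonals.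
[cite: FrancescoMathieuSenechal1997, §4.3.1 (4.51)–(4.54)] -/
theorem sctWardWeak_iff_latticeWard {ρ : ℝ → ℝ} {S : CorrFamily 3}
    (hlim : HasPointwiseScalingLimit (criticalCorr 3) ρ S) (Δ : ℝ) (n : ℕ) :
    SCTWardWeak S Δ n ↔
      ∀ (b : EuclideanSpace ℝ (Fin 3)) (φ : (Fin n → EuclideanSpace ℝ (Fin 3)) → ℝ),
        ContDiff ℝ ((⊤ : ℕ∞) : WithTop ℕ∞) φ → HasCompactSupport φ → tsupport φ ⊆ NonCoincident 3 n →
          Tendsto (fun δ => ∫ x, rescaledCorrelator (criticalCorr 3) ρ n δ x * sctTestOp Δ n b φ x)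
            (𝓝[>] (0:ℝ)) (𝓝 0) :=
  sctWardWeak_iff_latticeWard_of_continuousOn hlim (continuousOn_of_limit hlim n) Δ

/-- **The lattice door 7‴ ⇒ 7″** (the direction a lattice mechanism would use): asymptotic lattice Ward identities for the
rescaled critical correlators give the weak Ward identities of the limit. [cite: FrancescoMathieuSenechal1997, §4.3.1 (4.51)–(4.54)] -/
theorem sctWardWeak_of_latticeWard {ρ : ℝ → ℝ} {S : CorrFamily 3}
    (hlim : HasPointwiseScalingLimit (criticalCorr 3) ρ S) {Δ : ℝ}
    (hLW : ∀ (n : ℕ) (b : EuclideanSpace ℝ (Fin 3)) (φ : (Fin n → EuclideanSpace ℝ (Fin 3)) → ℝ),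
        ContDiff ℝ ((⊤ : ℕ∞) : WithTop ℕ∞) φ → HasCompactSupport φ → tsupport φ ⊆ NonCoincident 3 n →
          Tendsto (fun δ => ∫ x, rescaledCorrelator (criticalCorr 3) ρ n δ x * sctTestOp Δ n b φ x)
            (𝓝[>] (0:ℝ)) (𝓝 0)) :
    ∀ n, SCTWardWeak S Δ n :=
  fun n => (sctWardWeak_iff_latticeWard hlim Δ n).2 (hLW n)

/-- **The converse 7″ ⇒ 7‴** (necessity: the lattice residual is implied by the crux). [cite: FrancescoMathieuSenechal1997, §4.3.1 (4.51)–(4.54)] -/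
theorem latticeWard_of_sctWardWeak {ρ : ℝ → ℝ} {S : CorrFamily 3}
    (hlim : HasPointwiseScalingLimit (criticalCorr 3) ρ S) {Δ : ℝ} (hW : ∀ n, SCTWardWeak S Δ n) :
    ∀ (n : ℕ) (b : EuclideanSpace ℝ (Fin 3)) (φ : (Fin n → EuclideanSpace ℝ (Fin 3)) → ℝ),
        ContDiff ℝ ((⊤ : ℕ∞) : WithTop ℕ∞) φ → HasCompactSupport φ → tsupport φ ⊆ NonCoincident 3 n →
          Tendsto (fun δ => ∫ x, rescaledCorrelator (criticalCorr 3) ρ n δ x * sctTestOp Δ n b φ x)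
            (𝓝[>] (0:ℝ)) (𝓝 0) :=
  fun n => (sctWardWeak_iff_latticeWard hlim Δ n).1 (hW n)

/-! ## By name: item 1982 ⟺ the lattice Ward upgrade; crux ⟺ 1981 ∧ the lattice Ward upgrade -/

/-- **Item 1982 ⟺ the LATTICE Ward upgrade (7‴)**: every normalised non-degenerate Euclidean scale-covariant pointwise limit of
the critical `ℤ³` correlators is inversion covariant IFF, for every such `(ρ, Δ, S)`, the rescaled LATTICE correlators satisfy the
special-conformal Ward identities asymptotically in the weak sense (registered anchor of this file).
[cite: FrancescoMathieuSenechal1997, §4.3.1 eq. (4.62)] -/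
theorem inversionUpgradeNormalised_iff_latticeWardUpgrade : Summit.CriticalPhenomena.Ising3DConformalLimit.Theses.HyperoctahedralRP.InversionUpgradeNormalised ↔ (∀ (ρ : ℝ → ℝ) (Δ : ℝ) (S : Literature.Probability.LatticeModels.CorrFamily 3), (∀ δ ∈ Set.Ioc (0:ℝ) 1, 0 < ρ δ) → Literature.Probability.LatticeModels.HasPointwiseScalingLimit (Literature.Probability.LatticeModels.criticalCorr 3) ρ S → (∀ n z, z ∉ Literature.Probability.LatticeModels.NonCoincident 3 n → S n z = 0) → Literature.Probability.LatticeModels.IsNondegenerateTwoPoint S → Literature.Probability.LatticeModels.IsEuclideanInvariant S → Literature.Probability.LatticeModels.IsScaleCovariant Δ S → ∀ (n : ℕ) (b : EuclideanSpace ℝ (Fin 3)) (φ : (Fin n → EuclideanSpace ℝ (Fin 3)) → ℝ), ContDiff ℝ ((⊤ : ℕ∞) : WithTop ℕ∞) φ → HasCompactSupport φ → tsupport φ ⊆ Literature.Probability.LatticeModels.NonCoincident 3 n → Filter.Tendsto (fun δ => MeasureTheory.integral MeasureTheory.volume (fun x => Literature.Probability.LatticeModels.rescaledCorrelator (Literature.Probability.LatticeModels.criticalCorr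 3) ρ n δ x * Literature.Probability.LatticeModels.sctTestOp Δ n b φ x)) (nhdsWithin (0:ℝ) (Set.Ioi 0)) (nhds 0)) := by
  rw [inversionUpgradeNormalised_iff_wardUpgrade]
  refine forall_congr' fun ρ => forall_congr' fun Δ => forall_congr' fun S => forall_congr' fun _ =>
    forall_congr' fun hlim => forall_congr' fun _ => forall_congr' fun _ => forall_congr' fun _ =>
      forall_congr' fun _ => forall_congr' fun n => ?_
  exact sctWardWeak_iff_latticeWard hlim Δ n

/-- **Item 1982 ⟺ 7‴ in `S`-free (curried) form**: for every renormalisation `ρ` and exponent `Δ` under which the critical `ℤ³`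
correlators HAVE a normalised non-degenerate Euclidean `Δ`-scale-covariant pointwise limit, the rescaled lattice correlators
satisfy the special-conformal Ward identities asymptotically in the weak sense — the limit object does not occur in the
conclusion. [cite: FrancescoMathieuSenechal1997, §4.3.1 eq. (4.62)] -/
theorem inversionUpgradeNormalised_iff_latticeWardUpgrade' :
    HyperoctahedralRP.InversionUpgradeNormalised ↔
      ∀ (ρ : ℝ → ℝ) (Δ : ℝ), (∀ δ ∈ Set.Ioc (0:ℝ) 1, 0 < ρ δ) →
        (∃ S : CorrFamily 3, HasPointwiseScalingLimit (criticalCorr 3) ρ S ∧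
          (∀ n z, z ∉ NonCoincident 3 n → S n z = 0) ∧ IsNondegenerateTwoPoint S ∧ IsEuclideanInvariant S ∧
          IsScaleCovariant Δ S) →
        ∀ (n : ℕ) (b : EuclideanSpace ℝ (Fin 3)) (φ : (Fin n → EuclideanSpace ℝ (Fin 3)) → ℝ),
          ContDiff ℝ ((⊤ : ℕ∞) : WithTop ℕ∞) φ → HasCompactSupport φ → tsupport φ ⊆ NonCoincident 3 n →
            Tendsto (fun δ => ∫ x, rescaledCorrelator (criticalCorr 3) ρ n δ x * sctTestOp Δ n b φ x)
              (𝓝[>] (0:ℝ)) (𝓝 0) := by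
  rw [inversionUpgradeNormalised_iff_latticeWardUpgrade]
  constructor
  · rintro h ρ Δ hρ ⟨S, hlim, hnorm, hnd, heuc, hsc⟩
    exact h ρ Δ S hρ hlim hnorm hnd heuc hsc
  · intro h ρ Δ S hρ hlim hnorm hnd heuc hsc
    exact h ρ Δ hρ ⟨S, hlim, hnorm, hnd, heuc, hsc⟩

/-- **TIGHTNESS through the lattice door: crux ⟺ item 1981 ∧ the lattice Ward upgrade (7‴).**
[cite: DuminilCopinICM2022, §8.4] -/
theorem MoebiusLimitExists_iff_existence_and_latticeWardUpgrade :
    PerfectScreening.MoebiusLimitExists ↔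
      HyperoctahedralRP.ExistsScaleCovariantLimit ∧
      ∀ (ρ : ℝ → ℝ) (Δ : ℝ) (S : CorrFamily 3), (∀ δ ∈ Set.Ioc (0:ℝ) 1, 0 < ρ δ) →
        HasPointwiseScalingLimit (criticalCorr 3) ρ S → (∀ n z, z ∉ NonCoincident 3 n → S n z = 0) →
        IsNondegenerateTwoPoint S → IsEuclideanInvariant S → IsScaleCovariant Δ S →
        ∀ (n : ℕ) (b : EuclideanSpace ℝ (Fin 3)) (φ : (Fin n → EuclideanSpace ℝ (Fin 3)) → ℝ),
          ContDiff ℝ ((⊤ : ℕ∞) : WithTop ℕ∞) φ → HasCompactSupport φ → tsupport φ ⊆ NonCoincident 3 n →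
            Tendsto (fun δ => ∫ x, rescaledCorrelator (criticalCorr 3) ρ n δ x * sctTestOp Δ n b φ x)
              (𝓝[>] (0:ℝ)) (𝓝 0) := by
  rw [← inversionUpgradeNormalised_iff_latticeWardUpgrade]
  exact MoebiusLimitExists_iff_leaves

/-- Route LeeYangGap's spelling (this lead's route): `LeeYangGap.MoebiusLimitExists ⟺ 1981 ∧ 7‴`. [cite: DuminilCopinICM2022, §8.4] -/
theorem leeYangGap_MoebiusLimitExists_iff_existence_and_latticeWardUpgrade :
    LeeYangGap.MoebiusLimitExists ↔
      HyperoctahedralRP.ExistsScaleCovariantLimit ∧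
      ∀ (ρ : ℝ → ℝ) (Δ : ℝ) (S : CorrFamily 3), (∀ δ ∈ Set.Ioc (0:ℝ) 1, 0 < ρ δ) →
        HasPointwiseScalingLimit (criticalCorr 3) ρ S → (∀ n z, z ∉ NonCoincident 3 n → S n z = 0) →
        IsNondegenerateTwoPoint S → IsEuclideanInvariant S → IsScaleCovariant Δ S →
        ∀ (n : ℕ) (b : EuclideanSpace ℝ (Fin 3)) (φ : (Fin n → EuclideanSpace ℝ (Fin 3)) → ℝ),
          ContDiff ℝ ((⊤ : ℕ∞) : WithTop ℕ∞) φ → HasCompactSupport φ → tsupport φ ⊆ NonCoincident 3 n →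
            Tendsto (fun δ => ∫ x, rescaledCorrelator (criticalCorr 3) ρ n δ x * sctTestOp Δ n b φ x)
              (𝓝[>] (0:ℝ)) (𝓝 0) := by
  rw [← inversionUpgradeNormalised_iff_latticeWardUpgrade]
  exact leeYangGap_MoebiusLimitExists_iff_leaves

/-- Route SubPtolemyInterlacing's spelling (the bet route): `SubPtolemyInterlacing.MoebiusLimit ⟺ 1981 ∧ 7‴`.
[cite: DuminilCopinICM2022, §8.4] -/
theorem subPtolemyInterlacing_MoebiusLimit_iff_existence_and_latticeWardUpgrade :
    SubPtolemyInterlacing.MoebiusLimit ↔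
      HyperoctahedralRP.ExistsScaleCovariantLimit ∧
      ∀ (ρ : ℝ → ℝ) (Δ : ℝ) (S : CorrFamily 3), (∀ δ ∈ Set.Ioc (0:ℝ) 1, 0 < ρ δ) →
        HasPointwiseScalingLimit (criticalCorr 3) ρ S → (∀ n z, z ∉ NonCoincident 3 n → S n z = 0) →
        IsNondegenerateTwoPoint S → IsEuclideanInvariant S → IsScaleCovariant Δ S →
        ∀ (n : ℕ) (b : EuclideanSpace ℝ (Fin 3)) (φ : (Fin n → EuclideanSpace ℝ (Fin 3)) → ℝ),
          ContDiff ℝ ((⊤ : ℕ∞) : WithTop ℕ∞) φ → HasCompactSupport φ → tsupport φ ⊆ NonCoincident 3 n →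
            Tendsto (fun δ => ∫ x, rescaledCorrelator (criticalCorr 3) ρ n δ x * sctTestOp Δ n b φ x)
              (𝓝[>] (0:ℝ)) (𝓝 0) := by
  rw [← inversionUpgradeNormalised_iff_latticeWardUpgrade]
  exact subPtolemyInterlacing_MoebiusLimit_iff_leaves

end Summit.CriticalPhenomena.Ising3DConformalLimit.MoebiusLimitExistsLatticeWard

end
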